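import Summits.AtomisticToContinuum.HydrodynamicLimit.Theorems.DensityCap.Negative.Packing

/-!
# The TYPED hard-sphere gas is EXACTLY IDEAL above reduced density `6/π`

Negative-side structure (statement audit) for the crux `JParityClosure.DensityCap` (stmt-AtomisticToContinuum-13082),
standing disprover cycle 3 (`Cruxes/DensityCap/Disproof.lean` §11 (3), kernel-checking remark (ii) of §9): the typed
equation of state of `IsHardSphereEulerSolution` is `p = ρ θ Z(ρσ³)` with
`Z = hsCompressibility η = 1 + η · deriv hsExcessFreeEnergy η` and
`hsExcessFreeEnergy η = limsup_N (−N⁻¹ log hsFreeVolume η N)`. By VOLUME PACKING on `𝕋³` (`N ≥ 2` centres pairwise at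
minimal-image distance `> d` carry `N` disjoint embedded balls of radius `d/2`, so `N · (π/6) d³ ≤ 1`,
`card_mul_volume_le_one_of_separated`), the non-overlap set defining `hsFreeVolume η N` is EMPTY for `η > 6/π` and
`N ≥ 2` (`hsFreeVolume_eq_zero_of_dense`), hence — through the junk values `log 0 = 0` — the typed excess free
energy VANISHES IDENTICALLY on `(6/π, ∞)` (`hsExcessFreeEnergy_eq_zero_of_dense`), its derivative is `0` there,
`Z ≡ 1` (`hsCompressibility_eq_one_of_dense`) and `hsPressure σ ρ θ = ρ θ` whenever `ρσ³ > 6/π`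
(`hsPressure_eq_ideal_of_dense`): **above reduced density `6/π` the typed hard-sphere Euler system is literally the
ideal gas, i.e. the `σ = 0` member of the family** (`isHardSphereEulerSolution_iff_ideal_of_dense`). Physically the
hard-sphere pressure diverges at close packing `ρσ³ = √2 < 6/π`; the typed law has no pole and no memory of the
hard core there. Consequences recorded in the Disproof: (a) the implosion hypothesis `H = DenseExcursionAbovePacking`
(level `81/π > 6/π`) asks for a classical solution entering a regime where the typed PDE is the ideal gas — its paper
truth value is an artefact of the typing, not physics; (b) every guarded statement (`ρ_t σ³ < η₀`, `η₀` in the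
certified analyticity range of `Z`, `HsEosLowDensity` = stmt-0768, PROVED as `hsEosLowDensity_proof`) is immune.
No new `def`; small-model facts about the Statement's objects only. refuter-cdisprove-stmt-AtomisticToContinuum-13082-g3-0.
-/

noncomputable section

namespace Summit.AtomisticToContinuum.HydrodynamicLimit.Theorems.DensityCapNegative

open MeasureTheory Filter Set Topology Metric
open scoped ENNReal
open Literature.MathematicalPhysics.KineticTheory Literature.Analysis.FluidPDE
open Literature.Analysis.FunctionSpaces

/-! ## §1 Volume packing on the unit torus -/

/-- The minimal-image distance on the unit `3`-torus is `< 1` (it is at most `√3/2`). -/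
theorem euclidDist_lt_one (x y : T3) : Torus.euclidDist x y < 1 := by
  rw [Torus.euclidDist_eq]
  have h := Torus.norm_reprSym_le_holds (d := Fin 3) (x - y)
  simp only [Fintype.card_fin, Nat.cast_ofNat] at h
  have h3 : Real.sqrt 3 < 2 := by
    rw [show (2 : ℝ) = Real.sqrt (2 ^ 2) by rw [Real.sqrt_sq (by norm_num)]]
    exact Real.sqrt_lt_sqrt (by norm_num) (by norm_num)
  linarith

/-- **Volume packing on `𝕋³`.** If `N ≥ 2` points of the unit torus are pairwise at minimal-image distance `> d > 0`,
then `N · (π/6) · d³ ≤ 1`: the minimal-image balls of radius `d/2` about them are pairwise disjoint, embedded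
(`d < 1`, since some distance exceeds `d`), each of Haar volume `(π/6) d³`, inside a space of volume `1`. -/
theorem card_mul_volume_le_one_of_separated {N : ℕ} (hN : 2 ≤ N) {d : ℝ} (hd : 0 < d) (q : Fin N → T3)
    (hsep : ∀ i j, i ≠ j → d < Torus.euclidDist (q i) (q j)) : (N : ℝ) * (Real.pi / 6 * d ^ 3) ≤ 1 := by
  have hd1 : d < 1 := by
    have h01 : (⟨0, by omega⟩ : Fin N) ≠ ⟨1, by omega⟩ := by simp [Fin.ext_iff]
    exact (hsep _ _ h01).trans (euclidDist_lt_one _ _)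
  set B : Fin N → Set T3 := fun i => {y | Torus.euclidDist y (q i) < d / 2} with hB
  have hBm : ∀ i, MeasurableSet (B i) := fun i => measurableSet_euclidBall (q i) (d / 2)
  have hdisj : Set.PairwiseDisjoint (↑(Finset.univ : Finset (Fin N)) : Set (Fin N)) B := by
    intro i _ j _ hij
    show Disjoint (B i) (B j)
    rw [Set.disjoint_left]
    intro y hyi hyj
    have h1 := hsep i j hij
    have h2 := Torus.euclidDist_triangle (q i) y (q j)
    rw [Torus.euclidDist_comm (q i) y] at h2
    have hyi' : Torus.euclidDist y (q i) < d / 2 := hyi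
    have hyj' : Torus.euclidDist y (q j) < d / 2 := hyj
    linarith
  have hvolU : volume (⋃ i ∈ (Finset.univ : Finset (Fin N)), B i) = ∑ i ∈ (Finset.univ : Finset (Fin N)), volume (B i) :=
    measure_biUnion_finset hdisj fun i _ => hBm i
  have hball1 : volume (Metric.ball (0 : EuclideanSpace ℝ (Fin 3)) 1) = ENNReal.ofReal (Real.pi * 4 / 3) := by
    rw [EuclideanSpace.volume_ball_fin_three, ENNReal.ofReal_one, one_pow, one_mul]
  have hc0 : 0 ≤ (d / 2) ^ 3 * (Real.pi * 4 / 3) := by positivity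
  have hBvol : ∀ i, volume (B i) = ENNReal.ofReal ((d / 2) ^ 3 * (Real.pi * 4 / 3)) := by
    intro i
    rw [hB]
    show volume {y | Torus.euclidDist y (q i) < d / 2} = _
    rw [volume_euclidBall (by positivity) (by linarith) (q i), hball1, ← ENNReal.ofReal_mul (by positivity)]
  have hle : (N : ℝ≥0∞) * ENNReal.ofReal ((d / 2) ^ 3 * (Real.pi * 4 / 3)) ≤ 1 := by
    calc (N : ℝ≥0∞) * ENNReal.ofReal ((d / 2) ^ 3 * (Real.pi * 4 / 3))
        = ∑ i ∈ (Finset.univ : Finset (Fin N)), volume (B i) := by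
          rw [Finset.sum_congr rfl fun i _ => hBvol i, Finset.sum_const, Finset.card_univ, Fintype.card_fin,
            nsmul_eq_mul]
      _ = volume (⋃ i ∈ (Finset.univ : Finset (Fin N)), B i) := hvolU.symm
      _ ≤ 1 := prob_le_one
  have hreal := ENNReal.toReal_mono ENNReal.one_ne_top hle
  rw [ENNReal.toReal_mul, ENNReal.toReal_natCast, ENNReal.toReal_ofReal hc0, ENNReal.toReal_one] at hreal
  calc (N : ℝ) * (Real.pi / 6 * d ^ 3) = (N : ℝ) * ((d / 2) ^ 3 * (Real.pi * 4 / 3)) := by ring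
    _ ≤ 1 := hreal

/-! ## §2 The typed free volume, excess free energy and compressibility above `6/π` -/

/-- **The non-overlap set is empty above `6/π`**: `hsFreeVolume η N = 0` for `η > 6/π` and `N ≥ 2`
(`N` spheres of diameter `(η/N)^{1/3}` would occupy volume `N · (π/6) · η/N = πη/6 > 1`). -/
theorem hsFreeVolume_eq_zero_of_dense {η : ℝ} (hη : 6 / Real.pi < η) {N : ℕ} (hN : 2 ≤ N) :
    hsFreeVolume η N = 0 := by
  have hpi := Real.pi_pos
  have hη0 : 0 < η := lt_trans (by positivity) hη
  have hN0 : (0 : ℝ) < N := by exact_mod_cast (show 0 < N by omega)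
  have hdpos : 0 < (η / N) ^ (1 / 3 : ℝ) := Real.rpow_pos_of_pos (by positivity) _
  have hd3 : ((η / N) ^ (1 / 3 : ℝ)) ^ 3 = η / N := by
    rw [← Real.rpow_natCast, ← Real.rpow_mul (by positivity)]
    norm_num
  have hempty : {q : Fin N → T3 | ∀ i j, i ≠ j → (η / N) ^ (1 / 3 : ℝ) < Torus.euclidDist (q i) (q j)} = ∅ := by
    ext q
    simp only [Set.mem_setOf_eq, Set.mem_empty_iff_false, iff_false]
    intro hsep
    have h := card_mul_volume_le_one_of_separated hN hdpos q hsep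
    rw [hd3] at h
    have hNπ : (N : ℝ) * (Real.pi / 6 * (η / N)) = Real.pi * η / 6 := by
      field_simp
    rw [hNπ] at h
    rw [div_lt_iff₀ hpi] at hη
    nlinarith
  unfold hsFreeVolume
  rw [hempty, measure_empty, ENNReal.toReal_zero]

/-- Termwise: `−N⁻¹ log hsFreeVolume η N = 0` for `η > 6/π`, `N ≥ 2` (junk `log 0 = 0`). -/
theorem hsTerm_eq_zero_of_dense {η : ℝ} (hη : 6 / Real.pi < η) {N : ℕ} (hN : 2 ≤ N) :
    -(N : ℝ)⁻¹ * Real.log (hsFreeVolume η N) = 0 := by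
  rw [hsFreeVolume_eq_zero_of_dense hη hN, Real.log_zero, mul_zero]

/-- **The typed excess free energy vanishes identically above `6/π`.** -/
theorem hsExcessFreeEnergy_eq_zero_of_dense {η : ℝ} (hη : 6 / Real.pi < η) : hsExcessFreeEnergy η = 0 := by
  unfold hsExcessFreeEnergy
  have h : (fun N : ℕ => -(N : ℝ)⁻¹ * Real.log (hsFreeVolume η N)) =ᶠ[atTop] fun _ => (0 : ℝ) := by
    filter_upwards [eventually_ge_atTop 2] with N hN using hsTerm_eq_zero_of_dense hη hN
  rw [Filter.limsup_congr h]
  exact Filter.limsup_const (0 : ℝ)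

/-- Its derivative vanishes there too (the function is locally the constant `0`; no junk involved at this step). -/
theorem deriv_hsExcessFreeEnergy_eq_zero_of_dense {η : ℝ} (hη : 6 / Real.pi < η) :
    deriv hsExcessFreeEnergy η = 0 := by
  have h : hsExcessFreeEnergy =ᶠ[𝓝 η] fun _ => (0 : ℝ) := by
    filter_upwards [Ioi_mem_nhds hη] with x hx using hsExcessFreeEnergy_eq_zero_of_dense hx
  rw [h.deriv_eq]
  simp

/-- **The typed compressibility factor is exactly `1` above `6/π`.** -/
theorem hsCompressibility_eq_one_of_dense {η : ℝ} (hη : 6 / Real.pi < η) : hsCompressibility η = 1 := by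
  rw [hsCompressibility, deriv_hsExcessFreeEnergy_eq_zero_of_dense hη, mul_zero, add_zero]

/-- **The typed pressure law is the ideal-gas law above reduced density `6/π`**: `hsPressure σ ρ θ = ρ θ` whenever
`ρ σ³ > 6/π` — no pole at close packing `√2`, no memory of the hard core. -/
theorem hsPressure_eq_ideal_of_dense {σ ρ θ : ℝ} (h : 6 / Real.pi < ρ * σ ^ 3) : hsPressure σ ρ θ = ρ * θ := by
  rw [hsPressure, hsCompressibility_eq_one_of_dense h, mul_one]

/-! ## §3 Above `6/π` the typed hard-sphere Euler system IS the ideal gas -/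

/-- **Above reduced density `6/π` the typed hard-sphere Euler system is the `σ = 0` (ideal-gas) system.** For fields
with `ρ_t(x) σ³ > 6/π` on `[0,T) × 𝕋³`: `IsHardSphereEulerSolution σ T ρ u θ ↔ IsHardSphereEulerSolution 0 T ρ u θ`
(the pressure fields coincide pointwise, `hsPressure_eq_ideal_of_dense` and `hsPressure_zero`). So the typed
conjunct quantifies, through `T` arbitrary, over classical IDEAL-GAS evolutions in a regime where real hard spheres
are jammed (`√2 < 6/π`); only the tie to dilute data and the question whether such regimes are reachable classically
(`DiluteSelfConsistency`) stand between the conjunct and this junk. -/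
theorem isHardSphereEulerSolution_iff_ideal_of_dense {σ T : ℝ} {ρ θ : ℝ → T3 → ℝ} {u : ℝ → T3 → V3}
    (hdense : ∀ t ∈ Ico 0 T, ∀ x, 6 / Real.pi < ρ t x * σ ^ 3) :
    IsHardSphereEulerSolution σ T ρ u θ ↔ IsHardSphereEulerSolution 0 T ρ u θ := by
  have hp : ∀ t ∈ Ico 0 T, ∀ y, hsPressure σ (ρ t y) (θ t y) = hsPressure 0 (ρ t y) (θ t y) := by
    intro t ht y
    rw [hsPressure_eq_ideal_of_dense (hdense t ht y), Literature.Barriers.AtomisticToContinuum.hsPressure_zero]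
  have hpf : ∀ t ∈ Ico 0 T, (fun y => hsPressure σ (ρ t y) (θ t y)) = fun y => hsPressure 0 (ρ t y) (θ t y) :=
    fun t ht => funext (hp t ht)
  have hef : ∀ t ∈ Ico 0 T,
      (fun y => (totalEnergyDensity (ρ t y) (u t y) (θ t y) + hsPressure σ (ρ t y) (θ t y)) • u t y) =
        fun y => (totalEnergyDensity (ρ t y) (u t y) (θ t y) + hsPressure 0 (ρ t y) (θ t y)) • u t y := by
    intro t ht
    funext y
    rw [hp t ht y]
  constructor
  · intro h
    exact ⟨h.smooth_density, h.smooth_velocity, h.smooth_temperature, h.density_pos, h.temperature_pos, h.mass,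
      fun t ht x => by rw [← hpf t ht]; exact h.momentum t ht x,
      fun t ht x => by rw [← hef t ht]; exact h.energy t ht x⟩
  · intro h
    exact ⟨h.smooth_density, h.smooth_velocity, h.smooth_temperature, h.density_pos, h.temperature_pos, h.mass,
      fun t ht x => by rw [hpf t ht]; exact h.momentum t ht x,
      fun t ht x => by rw [hef t ht]; exact h.energy t ht x⟩

end Summit.AtomisticToContinuum.HydrodynamicLimit.Theorems.DensityCapNegative

end
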